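import Summits.RiemannHypothesis.RiemannHypothesis.Theses.WeilWindowFlow
import Literature.NumberTheory.LFunctions.WeilGroundState
import Literature.NumberTheory.LFunctions.WeilWindowSuzukiProofs

/-!
# Disproof of `GronwallLeakage` (crux stmt-RiemannHypothesis-1037, route WeilWindowFlow) — findings

Standing adversary file (refuter-cdisprove-stmt-RiemannHypothesis-1037). `ε := weilGroundEnergy`.
The crux `X = GronwallLeakage` reads
`∃ C, ∀ b a, 0 < b → b ≤ a → IntervalIntegrable C volume b a ∧ ε b * exp (-(∫ x in b..a, C x)) ≤ ε a`.

FINDINGS (all kernel-checked below unless marked NEAR-MISS):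
* `gronwallLeakage_false_of_not_riemannHypothesis` — X is RH-strength (`closes`): an unconditional
  kill of X is a disproof of RH or a proof that `log ε` has a singular part; neither is available.
* STRUCTURE: `gronwallLeakage_iff_pos_and_logAC` — X ⟺ (ε > 0 on (0,∞)) ∧ (log ε absolutely
  continuous on every [b, a] ⊂ (0,∞)). So X = "no conjugate point" ∧ "no singular drop"; vertical
  tangents / kinks of ε at prime-power entries a = (log n)/2 do NOT refute X (√-cusps are AC).
* LOAD-BEARING `0 < b` / TIGHTNESS AT 0⁺: `leakage_integral_unbounded_at_zero`,
  `rate_not_intervalIntegrable_from_zero`, `gronwallLeakage_false_without_posB` — by the PROVED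
  coercivity `weilQuadratic_coercive` (Bombieri 2000 Thm 12) ε(b) → +∞ as b → 0⁺, hence every
  admissible rate has `∫_b^a C → +∞` (b → 0⁺): C ∉ L¹(0, a), C is unbounded above near 0, and the
  variant of X with `0 ≤ b` (rate integrable down to the degenerate window) is FALSE.
* REFUTED STRENGTHENINGS: `not_gronwallLeakageConstRate` (no uniform exponential leakage
  ε(a) ≥ ε(b) e^{-K(a-b)}), `not_gronwallLeakageBoundedRate`, `not_globalWindowLipschitz`
  (ε is not Lipschitz on (0, A]; the `0 < b₀` of crux WindowLipschitz is load-bearing too).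
* DEGENERATE WINDOW: `weilGroundEnergy_zero` (ε 0 = sInf ∅ = 0) and
  `leakageLaw_from_zero_iff_riemannHypothesis` (the b = 0 instance of the law alone ⟺ RH).
* CONSEQUENCES provers may use: `weilGroundEnergy_antitone'` (ε antitone on (0,∞)),
  `weilGroundEnergy_unbounded_near_zero`, `weilGroundEnergy_pos_of_gronwallLeakage`,
  `gronwallLeakage_log_form`.
* TIGHTNESS AT +∞ (§6): `∫^∞ C = +∞`, i.e. inf_a ε(a) ≤ 0 unconditionally, by the dichotomy
  ¬RH ⇒ some ε(a) < 0 (PROVED: `exists_weilGroundEnergy_neg_of_not_riemannHypothesis`) /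
  RH ⇒ inf ε = 0 (NEAR-MISS `bottom_not_uniformly_positive_under_RH`, sorry: almost-periodicity of
  L ↦ Σ_γ e^{iγL}|ĝ(γ)|² with the test function g − g(· − L); needs the zero-side explicit formula
  with absolute convergence + simultaneous Dirichlet approximation); assembled in
  `weilGroundEnergy_not_uniformly_positive` / `leakage_integral_unbounded_at_top`.
WHY X RESISTS: with the coercive anchor, ¬X ⟺ (∃ a > 0, ε a ≤ 0) ∨ (log ε not AC on some [b, a] ⊂ (0,∞))
(`gronwallLeakage_iff_pos_and_logAC`). Since `closes : X → RH`, a proof of `RH → ¬X` would kill X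
unconditionally; both disjuncts were examined under RH and neither is available:
 (i) conjugate point under RH (ε(a₀) = 0): impossible on paper — a minimiser exists (Bombieri 2000 Thm 3;
     tree: `ConnesConsaniMoscovici2025_thm_3_6_holds.exists_isWeilGroundState`), and under RH
     `Q̄(u) ≥ Σ_γ |û(1/2+iγ)|²` (Fatou), so ε(a₀) = 0 forces the exponential-type-a₀ function û to vanish
     on all zeta ordinates, whose counting function N(T) ~ (T/2π) log T beats Jensen's O(T) bound ⇒ u = 0,
     contradiction. So disjunct (i) is exactly ¬RH (StrictUnderRH is morally a theorem).
 (ii) singular drop under RH: on a compact range [b, A] only finitely many prime powers enter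
     (a = (log n)/2); a continuous antitone function that is AC off a finite set is AC (Banach–Zarecki),
     so entry kinks / vertical tangents (arXiv:2106.01715 Fig. testeven2) cannot produce a singular part;
     between entries the prime form is a FIXED bounded translation-structured operator and only the
     support constraint moves (Hadamard domain variation) — no known mechanism for a Cantor part, and
     none can be certified numerically (k1 numerics cannot refute X: AC tolerates integrable spikes of C).
 Hence no unconditional kill: ¬X is (¬RH) ∨ (a singular-continuous log ε between prime-power entries).
-/

-- `Summit.RiemannHypothesis.RiemannHypothesis.…` repeats a namespace component by design (D-0017).
set_option linter.dupNamespace false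

namespace Summit.RiemannHypothesis.RiemannHypothesis.Cruxes.GronwallLeakage.Disproof

open MeasureTheory Set Filter
open Literature.NumberTheory.LFunctions
open Summit.RiemannHypothesis.RiemannHypothesis.Theses.WeilWindowFlow

noncomputable section

/-! ## §0 Basic facts on `ε = weilGroundEnergy` used throughout -/

/-- The unit sphere of the window `[-a, a]`, `a > 0`, is nonempty (as a set of values of `Re Q`). -/
theorem sphereValues_nonempty {a : ℝ} (ha : 0 < a) :
    {x : ℝ | ∃ g : ℝ → ℂ, IsWeilTest g ∧ tsupport g ⊆ Icc (-a) a ∧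
      ∫ t : ℝ, ‖g t‖ ^ 2 = 1 ∧ x = (weilQuadratic g).re}.Nonempty := by
  obtain ⟨g, hg, hsupp, hnorm⟩ := exists_isWeilTest_sphere ha
  exact ⟨_, g, hg, hsupp, hnorm, rfl⟩

/-- `ε` is antitone on `(0, ∞)`: a larger window has more test functions. [folklore] -/
theorem weilGroundEnergy_antitone' {b a : ℝ} (hb : 0 < b) (hba : b ≤ a) :
    weilGroundEnergy a ≤ weilGroundEnergy b := by
  refine csInf_le_csInf (bddBelow_weilQuadratic_sphere_holds a) (sphereValues_nonempty hb) ?_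
  rintro x ⟨g, hg, hsupp, hnorm, rfl⟩
  exact ⟨g, hg, hsupp.trans (Icc_subset_Icc (by linarith) hba), hnorm, rfl⟩

/-- Coercive blow-up at `0⁺` (from the PROVED `weilQuadratic_coercive`, Bombieri 2000 Thm 12):
for every level `A` there is `a₀ > 0` with `A ≤ ε(a)` for all `0 < a ≤ a₀`. -/
theorem weilGroundEnergy_unbounded_near_zero (A : ℝ) :
    ∃ a₀ : ℝ, 0 < a₀ ∧ ∀ a : ℝ, 0 < a → a ≤ a₀ → A ≤ weilGroundEnergy a := by
  obtain ⟨a₀, ha₀, H⟩ := weilQuadratic_coercive A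
  refine ⟨a₀, ha₀, fun a ha hale ↦ le_csInf (sphereValues_nonempty ha) ?_⟩
  rintro x ⟨g, hg, hsupp, hnorm, rfl⟩
  have h := H a ha hale g hg hsupp
  rwa [hnorm, mul_one] at h

/-- The degenerate window: `ε 0 = sInf ∅ = 0` (a test function with `tsupport ⊆ {0}` vanishes a.e.,
so it cannot have unit `L²` norm). [folklore] -/
theorem weilGroundEnergy_zero : weilGroundEnergy 0 = 0 := by
  have hempty : {x : ℝ | ∃ g : ℝ → ℂ, IsWeilTest g ∧ tsupport g ⊆ Icc (-0) 0 ∧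
      ∫ t : ℝ, ‖g t‖ ^ 2 = 1 ∧ x = (weilQuadratic g).re} = ∅ := by
    ext x
    simp only [mem_setOf_eq, mem_empty_iff_false, iff_false]
    rintro ⟨g, -, hsupp, hnorm, -⟩
    have h0 : ∀ᵐ t : ℝ ∂volume, t ∉ ({0} : Set ℝ) :=
      measure_eq_zero_iff_ae_notMem.1 (measure_singleton 0)
    have hae : (fun t ↦ ‖g t‖ ^ 2) =ᵐ[volume] fun _ ↦ (0 : ℝ) := by
      filter_upwards [h0] with t ht
      have hgt : g t = 0 := image_eq_zero_of_notMem_tsupport fun h ↦ ht (by simpa using hsupp h)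
      simp [hgt]
    rw [integral_congr_ae hae] at hnorm
    simp at hnorm
  show sInf _ = 0
  rw [hempty, Real.sInf_empty]

/-- The `b = 0` instance of the leakage law alone (`ε 0 · e^{…} ≤ ε a`, i.e. `0 ≤ ε a` for all `a > 0`)
is exactly the Riemann hypothesis (`weilGroundEnergy_nonneg_iff_holds`, Yoshida's criterion
`riemannHypothesis_iff_forall_weilPositivityOn`): the degenerate endpoint carries RH, while demanding
integrability of the rate from `0` is refutable (`gronwallLeakage_false_without_posB`). [folklore] -/
theorem leakageLaw_from_zero_iff_riemannHypothesis (C : ℝ → ℝ) :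
    (∀ a : ℝ, 0 < a →
        weilGroundEnergy 0 * Real.exp (-(∫ x in (0 : ℝ)..a, C x)) ≤ weilGroundEnergy a) ↔
      _root_.RiemannHypothesis := by
  simp only [weilGroundEnergy_zero, zero_mul]
  rw [riemannHypothesis_iff_forall_weilPositivityOn]
  exact forall₂_congr fun a ha ↦ weilGroundEnergy_nonneg_iff_holds ha

/-! ## §1 Calibration: `X` is RH-strength -/

/-- `X → RH` is the route's deciding theorem `closes`; contrapositive: any unconditional proof of
`¬ X` that goes through the positivity conjunct is a disproof of RH. -/
theorem gronwallLeakage_false_of_not_riemannHypothesis (h : ¬ _root_.RiemannHypothesis) :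
    ¬ GronwallLeakage :=
  fun hX ↦ h (Summit.RiemannHypothesis_iff.1 (closes hX))

/-- `X` forces STRICT positivity of the bottom at every window (coercive anchor + transport). -/
theorem weilGroundEnergy_pos_of_gronwallLeakage (hX : GronwallLeakage) {a : ℝ} (ha : 0 < a) :
    0 < weilGroundEnergy a := by
  obtain ⟨a₁, ha₁, H⟩ := exists_weilGroundEnergy_pos
  by_cases hle : a ≤ a₁
  · exact H a ha hle
  · obtain ⟨C, hC⟩ := hX
    have hlt : a₁ ≤ a := le_of_not_ge hle
    exact lt_of_lt_of_le (mul_pos (H a₁ ha₁ le_rfl) (Real.exp_pos _)) (hC a₁ a ha₁ hlt).2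

/-! ## §2 The leakage law and its tightness at `0⁺` (load-bearing `0 < b`) -/

/-- The bare two-window leakage law for a rate `C` (the matrix of `X` without the integrability
clause). -/
def LeakageLaw (C : ℝ → ℝ) : Prop :=
  ∀ b a : ℝ, 0 < b → b ≤ a →
    weilGroundEnergy b * Real.exp (-(∫ x in b..a, C x)) ≤ weilGroundEnergy a

theorem leakageLaw_of_gronwallLeakage_witness {C : ℝ → ℝ}
    (hC : ∀ b a : ℝ, 0 < b → b ≤ a → IntervalIntegrable C volume b a ∧
      weilGroundEnergy b * Real.exp (-(∫ x in b..a, C x)) ≤ weilGroundEnergy a) :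
    LeakageLaw C :=
  fun b a hb hba ↦ (hC b a hb hba).2

/-- CORE BLOW-UP LEMMA: no leakage law has `∫_b^a C` bounded above as `b → 0⁺` (a fixed).
Otherwise `ε(b) ≤ |ε(a)| e^{M}` for all small `b`, against the coercive blow-up `ε(b) → +∞`. -/
theorem leakage_integral_unbounded_at_zero {C : ℝ → ℝ} (hC : LeakageLaw C) {a : ℝ} (ha : 0 < a)
    (M : ℝ) (hM : ∀ b : ℝ, 0 < b → b ≤ a → ∫ x in b..a, C x ≤ M) : False := by
  obtain ⟨a₀, ha₀, hcoer⟩ :=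
    weilGroundEnergy_unbounded_near_zero (|weilGroundEnergy a| * Real.exp M + 1)
  set b : ℝ := min a₀ a with hb
  have hb0 : 0 < b := lt_min ha₀ ha
  have hba : b ≤ a := min_le_right _ _
  have hεb : |weilGroundEnergy a| * Real.exp M + 1 ≤ weilGroundEnergy b :=
    hcoer b hb0 (min_le_left _ _)
  have hnn : 0 ≤ |weilGroundEnergy a| * Real.exp M := by positivity
  have hεb0 : 0 ≤ weilGroundEnergy b := by linarith
  have hexp : Real.exp (-M) ≤ Real.exp (-(∫ x in b..a, C x)) :=
    Real.exp_le_exp.2 (by linarith [hM b hb0 hba])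
  have h1 : weilGroundEnergy b * Real.exp (-M) ≤ |weilGroundEnergy a| :=
    ((mul_le_mul_of_nonneg_left hexp hεb0).trans (hC b a hb0 hba)).trans (le_abs_self _)
  have h2 : weilGroundEnergy b ≤ |weilGroundEnergy a| * Real.exp M := by
    have h4 : weilGroundEnergy b = weilGroundEnergy b * Real.exp (-M) * Real.exp M := by
      rw [mul_assoc, ← Real.exp_add, neg_add_cancel, Real.exp_zero, mul_one]
    rw [h4]
    exact mul_le_mul_of_nonneg_right h1 (Real.exp_pos M).le
  linarith

/-- TIGHTNESS AT `0⁺`: an admissible rate is never integrable on `[0, a]` — the Grönwall integral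
`∫_b^a C` must diverge as `b → 0⁺` (at least like `log ε(b)`). "Any proof must let `C ∉ L¹(0,1)`." -/
theorem rate_not_intervalIntegrable_from_zero {C : ℝ → ℝ} (hC : LeakageLaw C) {a : ℝ}
    (ha : 0 < a) : ¬ IntervalIntegrable C volume 0 a := by
  intro hint
  refine leakage_integral_unbounded_at_zero hC ha (∫ x in (0 : ℝ)..a, |C x|) fun b hb hba ↦ ?_
  calc ∫ x in b..a, C x ≤ |∫ x in b..a, C x| := le_abs_self _
    _ ≤ ∫ x in b..a, |C x| := intervalIntegral.abs_integral_le_integral_abs hba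
    _ ≤ ∫ x in (0 : ℝ)..a, |C x| :=
        intervalIntegral.integral_mono_interval hb.le hba le_rfl
          (Eventually.of_forall fun x ↦ abs_nonneg (C x)) hint.abs

/-- The rate is UNBOUNDED ABOVE near `0⁺`: for every `M` and `a > 0` some `x ∈ (0, a]` has
`M < C x` (only integrability on the windows `[b, a]`, `b > 0`, is used). -/
theorem rate_unbounded_above_near_zero {C : ℝ → ℝ} (hC : LeakageLaw C)
    (hCi : ∀ b a : ℝ, 0 < b → b ≤ a → IntervalIntegrable C volume b a) {a : ℝ} (ha : 0 < a)
    (M : ℝ) : ∃ x : ℝ, 0 < x ∧ x ≤ a ∧ M < C x := by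
  by_contra h
  push Not at h
  refine leakage_integral_unbounded_at_zero hC ha (|M| * a) fun b hb hba ↦ ?_
  calc ∫ x in b..a, C x ≤ ∫ x in b..a, (fun _ ↦ |M|) x :=
        intervalIntegral.integral_mono_on hba (hCi b a hb hba) intervalIntegrable_const
          fun x hx ↦ (h x (hb.trans_le hx.1) hx.2).trans (le_abs_self M)
    _ = |M| * (a - b) := by simp [mul_comm]
    _ ≤ |M| * a := by nlinarith [abs_nonneg M, hb.le]

/-- `X` WITHOUT the side condition `0 < b` (i.e. the law and the integrability of the rate are
also demanded from the degenerate window `b = 0`, where `ε 0 = sInf ∅ = 0`). -/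
def GronwallLeakageWithoutPosB : Prop :=
  ∃ C : ℝ → ℝ, ∀ b a : ℝ, 0 ≤ b → b ≤ a → IntervalIntegrable C volume b a ∧
    weilGroundEnergy b * Real.exp (-(∫ x in b..a, C x)) ≤ weilGroundEnergy a

/-- LOAD-BEARING `0 < b`: the `0 ≤ b` variant is FALSE unconditionally (the rate would be
integrable on `[0, 1]`, contradicting `rate_not_intervalIntegrable_from_zero`). -/
theorem gronwallLeakage_false_without_posB : ¬ GronwallLeakageWithoutPosB := by
  rintro ⟨C, hC⟩
  exact rate_not_intervalIntegrable_from_zero (fun b a hb hba ↦ (hC b a hb.le hba).2) one_pos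
    (hC 0 1 le_rfl zero_le_one).1

/-! ## §3 Refuted natural strengthenings -/

/-- Uniform exponential leakage (constant rate `K`): `ε(a) ≥ ε(b) e^{-K (a - b)}`. -/
def GronwallLeakageConstRate : Prop :=
  ∃ K : ℝ, ∀ b a : ℝ, 0 < b → b ≤ a →
    weilGroundEnergy b * Real.exp (-(K * (a - b))) ≤ weilGroundEnergy a

/-- FALSE: no constant rate works (a constant is integrable on `[0, 1]`). So the content of `X`
is genuinely in the `a`-dependence of `C` near `0⁺` (and, conjecturally, `C(a) ~ c e^{2a}` at `+∞`). -/
theorem not_gronwallLeakageConstRate : ¬ GronwallLeakageConstRate := by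
  rintro ⟨K, hK⟩
  have hlaw : LeakageLaw (fun _ ↦ K) := by
    intro b a hb hba
    have e : (∫ x in b..a, (fun _ : ℝ ↦ K) x) = K * (a - b) := by
      simp only [intervalIntegral.integral_const, smul_eq_mul]; ring
    rw [e]
    exact hK b a hb hba
  exact rate_not_intervalIntegrable_from_zero hlaw one_pos intervalIntegrable_const

/-- Leakage with a rate bounded above on `(0, 1]`. -/
def GronwallLeakageBoundedRate : Prop :=
  ∃ C : ℝ → ℝ, (∃ M : ℝ, ∀ x : ℝ, 0 < x → x ≤ 1 → C x ≤ M) ∧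
    ∀ b a : ℝ, 0 < b → b ≤ a → IntervalIntegrable C volume b a ∧
      weilGroundEnergy b * Real.exp (-(∫ x in b..a, C x)) ≤ weilGroundEnergy a

/-- FALSE: the rate of any witness of `X` is unbounded above on `(0, 1]`. -/
theorem not_gronwallLeakageBoundedRate : ¬ GronwallLeakageBoundedRate := by
  rintro ⟨C, ⟨M, hM⟩, hC⟩
  obtain ⟨x, hx0, hx1, hMx⟩ := rate_unbounded_above_near_zero
    (leakageLaw_of_gronwallLeakage_witness hC) (fun b a hb hba ↦ (hC b a hb hba).1) one_pos M
  exact (lt_irrefl M) (hMx.trans_le (hM x hx0 hx1))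

/-- Global one-sided Lipschitz bound for `ε` on `(0, ∞)` (crux `WindowLipschitz` with its
`0 < b₀` dropped). -/
def GlobalWindowLipschitz : Prop :=
  ∃ L : ℝ, ∀ b a : ℝ, 0 < b → b ≤ a →
    weilGroundEnergy b - weilGroundEnergy a ≤ L * (a - b)

/-- FALSE: `ε(b) → +∞` as `b → 0⁺` while `ε(1)` is a real number, so no global Lipschitz (even
one-sided, even Hölder/any modulus finite at 0) bound holds down to `b = 0`. The `0 < b₀` in
`WindowLipschitz`/`DiniLeakage` is load-bearing. -/
theorem not_globalWindowLipschitz : ¬ GlobalWindowLipschitz := by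
  rintro ⟨L, hL⟩
  obtain ⟨a₀, ha₀, hcoer⟩ :=
    weilGroundEnergy_unbounded_near_zero (weilGroundEnergy 1 + |L| + 1)
  set b : ℝ := min a₀ 1 with hb
  have hb0 : 0 < b := lt_min ha₀ one_pos
  have hb1 : b ≤ 1 := min_le_right _ _
  have h1 := hL b 1 hb0 hb1
  have h2 := hcoer b hb0 (min_le_left _ _)
  have h3 : L * (1 - b) ≤ |L| := by
    have : L * (1 - b) ≤ |L| * (1 - b) :=
      mul_le_mul_of_nonneg_right (le_abs_self L) (by linarith)
    nlinarith [abs_nonneg L, hb0.le]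
  linarith

/-! ## §4 Structure theorem: `X` ⟺ strict positivity ∧ local absolute continuity of `log ε` -/

/-- Log form of the law for a witness of `X` (all quantities finite since `ε > 0`). -/
theorem gronwallLeakage_log_form (hX : GronwallLeakage) :
    ∃ C : ℝ → ℝ, ∀ b a : ℝ, 0 < b → b ≤ a → IntervalIntegrable C volume b a ∧
      0 ≤ Real.log (weilGroundEnergy b) - Real.log (weilGroundEnergy a) ∧
      Real.log (weilGroundEnergy b) - Real.log (weilGroundEnergy a) ≤ ∫ x in b..a, C x := by
  have hpos := fun a (ha : 0 < a) ↦ weilGroundEnergy_pos_of_gronwallLeakage hX ha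
  obtain ⟨C, hC⟩ := hX
  refine ⟨C, fun b a hb hba ↦ ⟨(hC b a hb hba).1, ?_, ?_⟩⟩
  · have := Real.log_le_log (hpos a (hb.trans_le hba)) (weilGroundEnergy_antitone' hb hba)
    linarith
  · have h := (hC b a hb hba).2
    have hb' := hpos b hb
    have ha' := hpos a (hb.trans_le hba)
    have h' := Real.log_le_log (mul_pos hb' (Real.exp_pos _)) h
    rw [Real.log_mul hb'.ne' (Real.exp_pos _).ne', Real.log_exp] at h'
    linarith

/-- Comparison principle for absolute continuity: a function dominated in oscillation by an
absolutely continuous one is absolutely continuous. [folklore] -/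
theorem absolutelyContinuousOnInterval_of_dist_le {f G : ℝ → ℝ} {a b : ℝ}
    (hG : AbsolutelyContinuousOnInterval G a b)
    (h : ∀ x ∈ uIcc a b, ∀ y ∈ uIcc a b, dist (f x) (f y) ≤ dist (G x) (G y)) :
    AbsolutelyContinuousOnInterval f a b := by
  rw [absolutelyContinuousOnInterval_iff] at hG ⊢
  intro ε hε
  obtain ⟨δ, hδ, hG⟩ := hG ε hε
  refine ⟨δ, hδ, fun E hE₁ hE₂ ↦ lt_of_le_of_lt ?_ (hG E hE₁ hE₂)⟩
  exact Finset.sum_le_sum fun i hi ↦ h _ (hE₁.1 i hi).1 _ (hE₁.1 i hi).2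

/-- `X` ⟹ `log ε` is absolutely continuous on every compact window range `[b, a] ⊂ (0, ∞)`. -/
theorem logAC_of_gronwallLeakage (hX : GronwallLeakage) {b a : ℝ} (hb : 0 < b) (hba : b ≤ a) :
    AbsolutelyContinuousOnInterval (fun x ↦ Real.log (weilGroundEnergy x)) b a := by
  obtain ⟨C, hC⟩ := gronwallLeakage_log_form hX
  have hint : IntervalIntegrable (fun x ↦ |C x|) volume b a := (hC b a hb hba).1.abs
  set G : ℝ → ℝ := fun x ↦ ∫ v in b..x, |C v| with hGdef
  have hG : AbsolutelyContinuousOnInterval G b a :=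
    hint.absolutelyContinuousOnInterval_intervalIntegral (c := b) (by simp)
  -- key estimate: for b ≤ x ≤ y ≤ a, 0 ≤ f x - f y ≤ ∫_x^y C ≤ ∫_x^y |C| = G y - G x
  have key : ∀ x y : ℝ, b ≤ x → x ≤ y → y ≤ a →
      dist (Real.log (weilGroundEnergy x)) (Real.log (weilGroundEnergy y)) ≤ dist (G x) (G y) := by
    intro x y hx hxy hy
    have hx0 : 0 < x := hb.trans_le hx
    obtain ⟨hCi, h0, h1⟩ := hC x y hx0 hxy
    have hxy_int : IntervalIntegrable (fun v ↦ |C v|) volume x y :=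
      hint.mono_set (by
        rw [uIcc_of_le hba, uIcc_of_le hxy]
        exact Icc_subset_Icc hx hy)
    have h2 : ∫ v in x..y, C v ≤ ∫ v in x..y, |C v| :=
      (le_abs_self _).trans (intervalIntegral.abs_integral_le_integral_abs hxy)
    have hGxy : G y - G x = ∫ v in x..y, |C v| := by
      simp only [hGdef]
      rw [intervalIntegral.integral_interval_sub_left
        (hint.mono_set (by rw [uIcc_of_le hba, uIcc_of_le (hx.trans hxy)]
                           exact Icc_subset_Icc le_rfl hy))
        (hint.mono_set (by rw [uIcc_of_le hba, uIcc_of_le hx]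
                           exact Icc_subset_Icc le_rfl (hxy.trans hy)))]
    have h3 : 0 ≤ ∫ v in x..y, |C v| :=
      intervalIntegral.integral_nonneg hxy fun v _ ↦ abs_nonneg _
    rw [Real.dist_eq, Real.dist_eq, abs_of_nonneg h0, abs_sub_comm, hGxy, abs_of_nonneg h3]
    exact h1.trans h2
  refine absolutelyContinuousOnInterval_of_dist_le hG fun x hx y hy ↦ ?_
  rw [uIcc_of_le hba] at hx hy
  rcases le_total x y with hxy | hyx
  · exact key x y hx.1 hxy hy.2
  · rw [dist_comm, dist_comm (G x)]
    exact key y x hy.1 hyx hx.2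

/-- STRUCTURE THEOREM. `X` ⟺ (strict positivity of the bottom at every window) ∧
(`log ε` absolutely continuous on every `[b, a] ⊂ (0, ∞)`). The reverse direction takes
`C := -deriv (log ∘ ε)` (FTC for absolutely continuous functions). Consequently
`¬X ⟺ (∃ a > 0, ε a ≤ 0) ∨ (log ε has a singular part on some compact window range)`. -/
theorem gronwallLeakage_iff_pos_and_logAC :
    GronwallLeakage ↔
      (∀ a : ℝ, 0 < a → 0 < weilGroundEnergy a) ∧
      (∀ b a : ℝ, 0 < b → b ≤ a →
        AbsolutelyContinuousOnInterval (fun x ↦ Real.log (weilGroundEnergy x)) b a) := by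
  constructor
  · exact fun hX ↦ ⟨fun a ha ↦ weilGroundEnergy_pos_of_gronwallLeakage hX ha,
      fun b a hb hba ↦ logAC_of_gronwallLeakage hX hb hba⟩
  · rintro ⟨hpos, hAC⟩
    refine ⟨fun x ↦ -deriv (fun y ↦ Real.log (weilGroundEnergy y)) x, fun b a hb hba ↦ ⟨?_, ?_⟩⟩
    · exact (hAC b a hb hba).intervalIntegrable_deriv.neg
    · have hftc := (hAC b a hb hba).integral_deriv_eq_sub
      rw [intervalIntegral.integral_neg, neg_neg, hftc]
      have hb' := hpos b hb
      have ha' := hpos a (hb.trans_le hba)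
      rw [Real.exp_sub, Real.exp_log ha', Real.exp_log hb', mul_div_cancel₀ _ hb'.ne']

/-! ## §5 Targets (lead's stuck stubs) — none registered yet (payload.stuck_stubs = []) -/

/-! ## §6 Tightness at `+∞`: proved ¬RH branch, NEAR-MISS RH branch (`sorry` permitted here only) -/

/-- ¬RH BRANCH (proved): if RH fails, the flow meets a conjugate point at a finite window —
some `ε(a) < 0` (Yoshida's criterion `riemannHypothesis_iff_forall_weilPositivityOn` and
`weilGroundEnergy_nonneg_iff_holds`). -/
theorem exists_weilGroundEnergy_neg_of_not_riemannHypothesis (h : ¬ _root_.RiemannHypothesis) :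
    ∃ a : ℝ, 0 < a ∧ weilGroundEnergy a < 0 := by
  rw [riemannHypothesis_iff_forall_weilPositivityOn] at h
  push Not at h
  obtain ⟨a, ha, hna⟩ := h
  exact ⟨a, ha, lt_of_not_ge fun h0 ↦ hna ((weilGroundEnergy_nonneg_iff_holds ha).1 h0)⟩

/-- NEAR-MISS (RH branch of the tightness at `+∞`): under RH the bottom is not bounded away from
`0` uniformly in the window. Sketch: under RH `Q(g - g(· - L)) = 2 Σ_γ m_γ (1 - cos γL) |ĝ(1/2+iγ)|²`
while `‖g - g(· - L)‖₂² = 2‖g‖₂²` (disjoint supports, `L` large); simultaneous Dirichlet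
approximation of `{γL/2π : 0 < γ ≤ T}` by integers (pigeonhole on the torus of dimension `N(T)`)
and the tail `Σ_{γ>T} |ĝ(1/2+iγ)|² → 0` (absolute convergence of the zero side for test functions)
make the quotient `< δ`. OBSTRUCTION to closing here: needs the explicit formula for `Q` on the
zero side with absolute convergence (in the tree only as the symmetric limit `explicit_formula`) and a
simultaneous Dirichlet theorem (Mathlib has the one-dimensional `Real.exists_int_int_abs_mul_sub_le`
only); a multi-day formalisation, not a refutation of `X`. -/
theorem bottom_not_uniformly_positive_under_RH (hRH : _root_.RiemannHypothesis) :
    ∀ δ : ℝ, 0 < δ → ∃ a : ℝ, 0 < a ∧ weilGroundEnergy a < δ := by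
  sorry

/-- Tightness at `+∞`, assembled from the two branches (depends on the NEAR-MISS above through
`bottom_not_uniformly_positive_under_RH`; stated as an implication to keep the dependence explicit). -/
theorem weilGroundEnergy_not_uniformly_positive
    (hRHbranch : _root_.RiemannHypothesis → ∀ δ : ℝ, 0 < δ → ∃ a : ℝ, 0 < a ∧ weilGroundEnergy a < δ) :
    ¬ ∃ δ : ℝ, 0 < δ ∧ ∀ a : ℝ, 0 < a → δ ≤ weilGroundEnergy a := by
  rintro ⟨δ, hδ, hall⟩
  by_cases hRH : _root_.RiemannHypothesis
  · obtain ⟨a, ha, hlt⟩ := hRHbranch hRH δ hδ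
    exact (lt_irrefl δ) ((hall a ha).trans_lt hlt)
  · obtain ⟨a, ha, hlt⟩ := exists_weilGroundEnergy_neg_of_not_riemannHypothesis hRH
    linarith [hall a ha]

theorem leakage_integral_unbounded_at_top
    (hinf : ¬ ∃ δ : ℝ, 0 < δ ∧ ∀ a : ℝ, 0 < a → δ ≤ weilGroundEnergy a)
    {C : ℝ → ℝ} (hC : LeakageLaw C) {a : ℝ} (ha : 0 < a) (hεa : 0 < weilGroundEnergy a)
    (M : ℝ) (hM : ∀ b : ℝ, a ≤ b → ∫ x in a..b, C x ≤ M) : False := by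
  refine hinf ⟨min (weilGroundEnergy a * Real.exp (-M)) (weilGroundEnergy a), ?_, fun b hb ↦ ?_⟩
  · exact lt_min (mul_pos hεa (Real.exp_pos _)) hεa
  · rcases le_total a b with hab | hba
    · have hexp : Real.exp (-M) ≤ Real.exp (-(∫ x in a..b, C x)) :=
        Real.exp_le_exp.2 (by linarith [hM b hab])
      exact (min_le_left _ _).trans
        ((mul_le_mul_of_nonneg_left hexp hεa.le).trans (hC a b ha hab))
    · exact (min_le_right _ _).trans (weilGroundEnergy_antitone' hb hba)

end

end Summit.RiemannHypothesis.RiemannHypothesis.Cruxes.GronwallLeakage.Disproof
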